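import Mathlib
import HarnessLib

/-!
# The Leibniz rule for iterated forward differences

Topic `Literature/Analysis/Calculus`.  For a scalar function `f : M → R` and a vector function
`g : M → G` (`G` an `R`-module, `M` an additive commutative monoid, step `h : M`):

* `fwdDiff_smul_shift` — `Δ_h (f • g) = Δ_h f • g(· + h) + f • Δ_h g` (the product rule with the
  shift on ONE factor; Mathlib's `fwdDiff_smul` is the symmetric three-term form);
* **`fwdDiff_iter_smul_eq_sum`** — BOOLE'S LEIBNIZ RULE
  `Δ_hⁿ (f • g)(y) = Σ_{k=0}^{n} C(n,k) • (Δ_hᵏ f)(y) • (Δ_h^{n−k} g)(y + k•h)`;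
* `fwdDiff_iter_mul_eq_sum` — the same for two scalar functions;
* `fwdDiff_iter_smul_eq_sum_of_eq_zero` — if `Δ_hᵏ f = 0` for `k > d` (a polynomial prefactor of
  degree `≤ d`) the sum stops at `k = d`, for every `n`;
* `fwdDiff_iter_smul_of_quadratic` — the case `d = 2` spelled out (three terms), the form used for
  the tilted block statistics of `Literature/Combinatorics/Optimization/ShellLawEdgeProduct` §7
  (a quadratic level profile times a shell-law profile).

Everything is proved; no definitions, no named facts.

## References

* [Boole2009] G. Boole, *A Treatise on the Calculus of Finite Differences* (1860; CUP reprint 2009),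
  Ch. II, Art. 10, Ex. 3, eq. (8) (PDF pp. 34–35): `Δⁿ u_x v_x = Σ_r C(n,r) Δ^{n−r} u_{x+r} · Δ^r v_x`.
* [MaricondaTonolo2016] C. Mariconda, A. Tonolo, *Discrete Calculus*, Springer 2016, Prop. 6.13
  (PDF p. 144): `Δ(fg) = Δf · θg + f · Δg` (`θ` the shift).
-/

open Finset fwdDiff

namespace Literature.Analysis

variable {M R G : Type*} [AddCommMonoid M] [Ring R] [AddCommGroup G] [Module R G] (h : M)

/-- The product rule with the shift on the second factor:
`Δ_h (f • g)(y) = Δ_h f(y) • g(y + h) + f(y) • Δ_h g(y)`.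
[cite: MaricondaTonolo2016, Prop. 6.13 (PDF p. 144)] -/
theorem fwdDiff_smul_shift (f : M → R) (g : M → G) :
    Δ_[h] (f • g) = Δ_[h] f • (fun x => g (x + h)) + f • Δ_[h] g := by
  ext x
  simp only [fwdDiff, Pi.smul_apply', Pi.add_apply, smul_sub, sub_smul]
  abel

/-- Pascal recombination of the two sums in the induction step of the Leibniz rule. [folklore] -/
private theorem pascal_sum {A : Type*} [AddCommMonoid A] (n : ℕ) (a : ℕ → A) :
    ∑ k ∈ range (n + 1), n.choose k • a (k + 1) + ∑ k ∈ range (n + 1), n.choose k • a k =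
      ∑ k ∈ range (n + 1 + 1), (n + 1).choose k • a k := by
  rw [sum_range_succ' (fun k => (n + 1).choose k • a k), Nat.choose_zero_right, one_nsmul]
  have e : ∀ k ∈ range (n + 1), (n + 1).choose (k + 1) • a (k + 1) =
      n.choose k • a (k + 1) + n.choose (k + 1) • a (k + 1) := by
    intro k _
    rw [Nat.choose_succ_succ', add_nsmul]
  rw [sum_congr rfl e, sum_add_distrib, sum_range_succ (fun k => n.choose (k + 1) • a (k + 1)) n,
    Nat.choose_succ_self, zero_nsmul, add_zero, sum_range_succ' (fun k => n.choose k • a k) n,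
    Nat.choose_zero_right, one_nsmul]
  abel

/-- **Boole's Leibniz rule for differences**: for `f : M → R`, `g : M → G`,
`Δ_hⁿ (f • g)(y) = Σ_{k=0}^{n} C(n,k) • (Δ_hᵏ f)(y) • (Δ_h^{n−k} g)(y + k • h)`
(symbolically `Δⁿ(uv) = (Δ + DΔ′)ⁿ uv`, `D` the shift acting on the differenced factor's partner).
[cite: Boole2009, Ch. II Art. 10 Ex. 3 eq. (8) (PDF pp. 34–35)] -/
theorem fwdDiff_iter_smul_eq_sum (f : M → R) (g : M → G) (n : ℕ) (y : M) :
    Δ_[h] ^[n] (f • g) y =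
      ∑ k ∈ range (n + 1), n.choose k • (Δ_[h] ^[k] f y • Δ_[h] ^[n - k] g (y + k • h)) := by
  induction n generalizing f g y with
  | zero => simp
  | succ n ih =>
    rw [Function.iterate_succ_apply, fwdDiff_smul_shift, fwdDiff_iter_add, Pi.add_apply, ih, ih]
    have e1 : ∀ k ∈ range (n + 1),
        n.choose k • (Δ_[h] ^[k] (Δ_[h] f) y • Δ_[h] ^[n - k] (fun x => g (x + h)) (y + k • h)) =
          n.choose k • (Δ_[h] ^[k + 1] f y • Δ_[h] ^[n + 1 - (k + 1)] g (y + (k + 1) • h)) := by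
      intro k _
      rw [fwdDiff_iter_comp_add, ← Function.iterate_succ_apply, Nat.add_sub_add_right, succ_nsmul,
        ← add_assoc]
    have e2 : ∀ k ∈ range (n + 1),
        n.choose k • (Δ_[h] ^[k] f y • Δ_[h] ^[n - k] (Δ_[h] g) (y + k • h)) =
          n.choose k • (Δ_[h] ^[k] f y • Δ_[h] ^[n + 1 - k] g (y + k • h)) := by
      intro k hk
      rw [← Function.iterate_succ_apply, Nat.sub_add_comm (by simpa [Nat.lt_succ_iff] using hk)]
    rw [sum_congr rfl e1, sum_congr rfl e2]
    exact pascal_sum n fun k => Δ_[h] ^[k] f y • Δ_[h] ^[n + 1 - k] g (y + k • h)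

/-- The Leibniz rule for two scalar functions with values in a commutative ring.
[cite: Boole2009, Ch. II Art. 10 Ex. 3 eq. (8) (PDF pp. 34–35)] -/
theorem fwdDiff_iter_mul_eq_sum {S : Type*} [CommRing S] (f g : M → S) (n : ℕ) (y : M) :
    Δ_[h] ^[n] (f * g) y =
      ∑ k ∈ range (n + 1), (n.choose k : S) * (Δ_[h] ^[k] f y * Δ_[h] ^[n - k] g (y + k • h)) := by
  have e : f * g = f • g := rfl
  rw [e, fwdDiff_iter_smul_eq_sum]
  simp only [smul_eq_mul, nsmul_eq_mul]

omit [Module R G] in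
/-- Iterated differences of the zero function vanish. [folklore] -/
private theorem fwdDiff_iter_zero (j : ℕ) : Δ_[h] ^[j] (0 : M → G) = 0 := by
  induction j with
  | zero => rfl
  | succ j ih =>
    rw [Function.iterate_succ_apply]
    have : Δ_[h] (0 : M → G) = 0 := by ext x; simp [fwdDiff]
    rw [this, ih]

/-- **Truncated Leibniz rule**: if `Δ_hᵏ f = 0` for all `k > d` (e.g. `f` a polynomial of degree
`≤ d` in the variable along `h`), then for EVERY `n`
`Δ_hⁿ (f • g)(y) = Σ_{k=0}^{d} C(n,k) • (Δ_hᵏ f)(y) • (Δ_h^{n−k} g)(y + k • h)` — only the differences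
of orders `n−d, …, n` of `g` enter. [cite: Boole2009, Ch. II Art. 10 Ex. 3 eq. (8) (PDF pp. 34–35)] -/
theorem fwdDiff_iter_smul_eq_sum_of_eq_zero (f : M → R) (g : M → G) {d : ℕ}
    (hf : ∀ k, d < k → Δ_[h] ^[k] f = 0) (n : ℕ) (y : M) :
    Δ_[h] ^[n] (f • g) y =
      ∑ k ∈ range (d + 1), n.choose k • (Δ_[h] ^[k] f y • Δ_[h] ^[n - k] g (y + k • h)) := by
  rw [fwdDiff_iter_smul_eq_sum]
  rcases le_total n d with hnd | hdn
  · refine sum_subset (range_subset_range.2 (by omega)) fun k _ hk' => ?_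
    rw [mem_range, not_lt] at hk'
    rw [Nat.choose_eq_zero_of_lt (by omega), zero_nsmul]
  · refine (sum_subset (range_subset_range.2 (by omega)) fun k _ hk' => ?_).symm
    rw [mem_range, not_lt] at hk'
    rw [hf k (by omega), Pi.zero_apply, zero_smul, smul_zero]

/-- **Quadratic prefactor**: if `Δ_h³ f = 0` then for every `n`
`Δ_hⁿ (f • g)(y) = f(y) • Δ_hⁿ g(y) + n • Δ_h f(y) • Δ_h^{n−1} g(y + h) + C(n,2) • Δ_h² f(y) • Δ_h^{n−2} g(y + 2•h)`
(for `n = 0, 1` the terms with `n − k < 0` carry the factor `C(n,k) = 0`).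
[cite: Boole2009, Ch. II Art. 10 Ex. 3 eq. (8) (PDF pp. 34–35)] -/
theorem fwdDiff_iter_smul_of_quadratic (f : M → R) (g : M → G) (hf : Δ_[h] ^[3] f = 0) (n : ℕ)
    (y : M) :
    Δ_[h] ^[n] (f • g) y =
      f y • Δ_[h] ^[n] g y + n • (Δ_[h] f y • Δ_[h] ^[n - 1] g (y + h)) +
        n.choose 2 • (Δ_[h] ^[2] f y • Δ_[h] ^[n - 2] g (y + 2 • h)) := by
  have hf' : ∀ k, 2 < k → Δ_[h] ^[k] f = 0 := by
    intro k hk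
    obtain ⟨j, rfl⟩ := Nat.exists_eq_add_of_le hk
    rw [add_comm, Function.iterate_add_apply, hf, fwdDiff_iter_zero]
  rw [fwdDiff_iter_smul_eq_sum_of_eq_zero h f g hf' n y]
  simp only [sum_range_succ, sum_range_zero, zero_add, Nat.choose_zero_right, one_nsmul,
    Function.iterate_zero, id_eq, zero_nsmul, add_zero, Nat.sub_zero, Nat.choose_one_right,
    Function.iterate_one, one_nsmul]

end Literature.Analysis
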